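import Literature.NumberTheory.EllipticCurves.RealLatticePeriod
import Mathlib.NumberTheory.ModularForms.EisensteinSeries.UniformConvergence
import HarnessLib

/-!
# Division values of `℘'` on `ℤi + ℤ` as values of Hecke's level-`N` Eisenstein series of weight 3
# (Matthews 1979, §8, (8.5)–(8.10))

Topic `Literature/NumberTheory/GaussSums` (part of the formal map of Matthews' determination of
the sign of the quartic Gauss sum, `MatthewsQuarticSign.lean` / `MatthewsQuarticSignProofs.lean`;
this file is the first, purely analytic-combinatorial step of his §8 "Loxton's conjecture", the
deduction of Theorem 2 from Theorem 1).

Matthews, *Gauss sums and elliptic functions II. The quartic sum*, Invent. Math. 54 (1979),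
§8, pp. 43–44: "Let `a₁, a₂` be rational integers, not both divisible by `p`. For `τ` in the upper
half plane we define with Hecke
(8.5) `G₃(τ; a₁, a₂; p) = G₃(τ; a₁, a₂) = ∑_{m_i ≡ a_i} (m₁τ + m₂)⁻³`,
the summation being over the pairs `m₁, m₂ ∈ ℤ` with `m_i ≡ a_i mod p`. The series expansion
`℘'(z) = -2 ∑_{m,n} {z + (m + ni)θ}⁻³` gives immediately
(8.6) `℘'(rθ/ρ) = -2p³θ⁻³ G₃(i; -rA, rB; p)` [`ρ = Ai + B`, `p = A² + B²`]. … We have the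
transformation formula
(8.9) `G₃(h(τ); a₁, a₂) = (cτ + d)³ G₃(τ; aa₁ + ca₂, ba₁ + da₂)` [`h = (a b; c d) ∈ SL₂(ℤ)`]
which follows directly from (8.5). Applying this to `g⁻¹g` we find, using (8.8)
[`g = (e f; -A B)`, `eB + fA = 1`], that `G₃(i; -rA, rB) = ρ̄⁻³ G₃(g(i); 0, r)` since
`ρ̄ = -Ai + B` … Therefore from (8.6) we see
(8.10) `℘'(rθ/ρ) = -2ρ³θ⁻³ G₃(g(i); 0, r; p)`."

Here `℘` is Matthews' function with `℘'² = 4℘³ - ℘`, lattice `ℤ[i]θ`; by homogeneity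
(`℘'_{θΛ}(θz) = θ⁻³ ℘'_Λ(z)`, the tree's `PeriodPair.derivWeierstrassP_mulLeft`) the factor
`θ⁻³` disappears when everything is stated, as below, for the Gaussian period pair
`Λᵢ = (i, 1)` of the tree (`PeriodPair.ofUpperHalfPlane UpperHalfPlane.I`, lattice `ℤi + ℤ`,
cluster `GaussianLatticeQuarterValues`), whose `℘'` is Mathlib's lattice sum
`℘'[Λ] z = -∑_{l ∈ Λ} 2/(z - l)³` (`PeriodPair.derivWeierstrassP`). Nothing requires `p` to be
prime: `N = A² + B² ≠ 0` suffices.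

## Main statements (namespace `Literature.NumberTheory.GaussSums.HeckeEisenstein`)

* `heckeG N k a τ` — **Hecke's Eisenstein series** `G_k(τ; a; N) = ∑_{v ≡ a (N)} (v₀τ + v₁)^{-k}`
  over ALL pairs `v ∈ ℤ²` in the class `a` (Matthews (8.5); Mathlib's `eisensteinSeries a k` is
  the sub-sum over the coprime pairs), with `summable_heckeG` (`k ≥ 3`).
* `heckeG_smul` — **(8.9)**: `G_k(γτ; a) = (cτ + d)^k G_k(τ; a ᵥ* γ)` for `γ ∈ SL₂(ℤ)`.
* `derivWeierstrassP_gaussian_div` — **(8.6)**: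
  `℘'[Λᵢ](r/(Ai + B)) = -2N³ G₃(i; -rA, rB; N)` for `N = A² + B² ≠ 0`.
* `derivWeierstrassP_gaussian_div_eq_smul` — **(8.10)**: for `γ = (e f; -A B) ∈ SL₂(ℤ)`,
  `℘'[Λᵢ](r/(Ai + B)) = -2N³ (B - Ai)⁻³ G₃(γ·i; 0, r; N)`.

The only definition is `heckeG` (with its summation set `congrPairs`); no named facts.
-/

noncomputable section

open Complex UpperHalfPlane EisensteinSeries PeriodPair Matrix
open scoped MatrixGroups

namespace Literature.NumberTheory.GaussSums

namespace HeckeEisenstein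

/-! ### Hecke's all-pairs Eisenstein series (8.5) -/

/-- The pairs `v ∈ ℤ²` in the residue class `a (mod N)` (no coprimality condition; the disjoint
union over `r` of Mathlib's `EisensteinSeries.gammaSet N r a`). [cite: Matthews1979Quartic, §8 (8.5) p. 43] -/
def congrPairs (N : ℕ) (a : Fin 2 → ZMod N) : Set (Fin 2 → ℤ) :=
  {v | ((↑) : ℤ → ZMod N) ∘ v = a}

/-- Membership in `congrPairs`. [folklore] -/
@[simp] theorem mem_congrPairs {N : ℕ} {a : Fin 2 → ZMod N} {v : Fin 2 → ℤ} :
    v ∈ congrPairs N a ↔ ((↑) : ℤ → ZMod N) ∘ v = a := Iff.rfl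

/-- **Hecke's Eisenstein series of weight `k`, level `N` and class `a`**, summed over all pairs
`m ≡ a (mod N)`: `G_k(τ; a₁, a₂; N) = ∑_{m_i ≡ a_i} (m₁τ + m₂)^{-k}` (Matthews (8.5), after Hecke).
[cite: Matthews1979Quartic, §8 (8.5) p. 43] -/
def heckeG (N : ℕ) (k : ℤ) (a : Fin 2 → ZMod N) (τ : ℍ) : ℂ :=
  ∑' v : congrPairs N a, eisSummand k v τ

/-- Unfolding of `heckeG`. [folklore] -/
theorem heckeG_def (N : ℕ) (k : ℤ) (a : Fin 2 → ZMod N) (τ : ℍ) :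
    heckeG N k a τ = ∑' v : congrPairs N a, eisSummand k v τ := rfl

/-- The weight-`k` lattice sums converge absolutely for `k ≥ 3` (Mathlib's box estimate
`EisensteinSeries.summable_one_div_norm_rpow` and `summand_bound`). [folklore] -/
theorem summable_norm_eisSummand {k : ℤ} (hk : 3 ≤ k) (τ : ℍ) :
    Summable fun v : Fin 2 → ℤ ↦ ‖eisSummand k v τ‖ := by
  have hk' : (2 : ℝ) < k := by exact_mod_cast (show (2 : ℤ) < k by omega)
  have hk0 : (0 : ℝ) ≤ k := by exact_mod_cast (show (0 : ℤ) ≤ k by omega)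
  refine Summable.of_nonneg_of_le (fun _ ↦ norm_nonneg _) (fun v ↦ ?_)
    ((summable_one_div_norm_rpow hk').mul_left (r τ ^ (-(k : ℝ))))
  have h := summand_bound τ hk0 v
  rw [eisSummand, norm_zpow, ← Real.rpow_intCast, Int.cast_neg]
  exact h

/-- `G_k(τ; a; N)` converges absolutely for `k ≥ 3`. [folklore] -/
theorem summable_heckeG {k : ℤ} (hk : 3 ≤ k) (N : ℕ) (a : Fin 2 → ZMod N) (τ : ℍ) :
    Summable fun v : congrPairs N a ↦ eisSummand k v τ :=
  ((summable_norm_eisSummand hk τ).of_norm).subtype _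

/-! ### The transformation formula (8.9) -/

/-- Right multiplication by `γ ∈ SL₂(ℤ)` maps the class `a` to the class `a ᵥ* γ`. [folklore] -/
theorem vecMul_mem_congrPairs {N : ℕ} {a : Fin 2 → ZMod N} {v : Fin 2 → ℤ}
    (hv : v ∈ congrPairs N a) (γ : SL(2, ℤ)) : v ᵥ* (γ : Matrix (Fin 2) (Fin 2) ℤ) ∈ congrPairs N (a ᵥ* γ) := by
  rw [mem_congrPairs] at hv ⊢
  have := RingHom.map_vecMul (m := Fin 2) (n := Fin 2) (Int.castRingHom (ZMod N)) γ v
  simp only [eq_intCast, Int.coe_castRingHom] at this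
  simp_rw [Function.comp_def, this, ← hv]
  simp [Function.comp_def]

/-- The bijection `congrPairs N a ≃ congrPairs N (a ᵥ* γ)`, `v ↦ v γ`. [folklore] -/
def congrPairsEquiv {N : ℕ} (a : Fin 2 → ZMod N) (γ : SL(2, ℤ)) :
    congrPairs N a ≃ congrPairs N (a ᵥ* γ) where
  toFun v := ⟨v.1 ᵥ* (γ : Matrix (Fin 2) (Fin 2) ℤ), vecMul_mem_congrPairs v.2 γ⟩
  invFun v := ⟨v.1 ᵥ* ((γ⁻¹ : SL(2, ℤ)) : Matrix (Fin 2) (Fin 2) ℤ), by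
      have := vecMul_mem_congrPairs v.2 γ⁻¹
      rw [vecMul_vecMul, ← SpecialLinearGroup.coe_mul] at this
      simpa only [SpecialLinearGroup.map_apply_coe, RingHom.mapMatrix_apply, Int.coe_castRingHom,
        map_inv, mul_inv_cancel, SpecialLinearGroup.coe_one, vecMul_one]⟩
  left_inv v := by
    ext1
    simp_rw [vecMul_vecMul, ← SpecialLinearGroup.coe_mul, mul_inv_cancel,
      SpecialLinearGroup.coe_one, vecMul_one]
  right_inv v := by
    ext1
    simp_rw [vecMul_vecMul, ← SpecialLinearGroup.coe_mul, inv_mul_cancel,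
      SpecialLinearGroup.coe_one, vecMul_one]

/-- **Matthews (8.9)** (Hecke): `G_k(γτ; a; N) = (cτ + d)^k G_k(τ; a ᵥ* γ; N)` for
`γ = (a b; c d) ∈ SL₂(ℤ)`, i.e. with `a ᵥ* γ = (a a₁ + c a₂, b a₁ + d a₂)`.
[cite: Matthews1979Quartic, §8 (8.9) p. 44] -/
theorem heckeG_smul (N : ℕ) (k : ℤ) (a : Fin 2 → ZMod N) (γ : SL(2, ℤ)) (τ : ℍ) :
    heckeG N k a (γ • τ) = denom γ τ ^ k * heckeG N k (a ᵥ* γ) τ := by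
  rw [heckeG, heckeG, ← (congrPairsEquiv a γ).tsum_eq (fun v ↦ eisSummand k v τ), ← tsum_mul_left]
  refine tsum_congr fun v ↦ ?_
  rw [eisSummand_SL2_apply]
  rfl

/-! ### Division values of `℘'` on `ℤi + ℤ`: (8.6) and (8.10) -/

/-- The Gaussian period pair `(i, 1)` (lattice `ℤi + ℤ`), local notation as in
`GaussianLatticeQuarterValues`. -/
local notation "Λᵢ" => PeriodPair.ofUpperHalfPlane UpperHalfPlane.I

/-- The reindexing `ℤ² ≃ {m ≡ (-rA, rB) (N)}`, `(v₀, v₁) ↦ (-rA - Nv₀, rB - Nv₁)` behind (8.6).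
[folklore] -/
def gaussianDivEquiv (A B r : ℤ) (N : ℕ) (hN : N ≠ 0) :
    (Fin 2 → ℤ) ≃ congrPairs N ![((-(r * A) : ℤ) : ZMod N), ((r * B : ℤ) : ZMod N)] where
  toFun v := ⟨![-(r * A) - N * v 0, r * B - N * v 1], by
      rw [mem_congrPairs]
      ext i
      fin_cases i <;> simp⟩
  invFun m := ![(-(r * A) - m.1 0) / N, (r * B - m.1 1) / N]
  left_inv v := by
    have hN' : (N : ℤ) ≠ 0 := by exact_mod_cast hN
    have e0 : (N : ℤ) * v 0 / N = v 0 := Int.mul_ediv_cancel_left _ hN'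
    have e1 : (N : ℤ) * v 1 / N = v 1 := Int.mul_ediv_cancel_left _ hN'
    ext i
    fin_cases i
    · simp [e0]
    · simp [e1]
  right_inv m := by
    obtain ⟨m, hm⟩ := m
    have hN' : (N : ℤ) ≠ 0 := by exact_mod_cast hN
    rw [mem_congrPairs] at hm
    have h0 := congrFun hm 0
    have h1 := congrFun hm 1
    simp only [Function.comp_apply, cons_val_zero, cons_val_one] at h0 h1
    rw [ZMod.intCast_eq_intCast_iff_dvd_sub] at h0 h1
    obtain ⟨c, hc⟩ := h0
    obtain ⟨d, hd⟩ := h1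
    have e0 : -(r * A) - N * ((-(r * A) - m 0) / N) = m 0 := by
      rw [hc, Int.mul_ediv_cancel_left _ hN']
      linarith
    have e1 : r * B - N * ((r * B - m 1) / N) = m 1 := by
      rw [hd, Int.mul_ediv_cancel_left _ hN']
      linarith
    apply Subtype.ext
    ext i
    fin_cases i
    · simp [e0]
    · simp [e1]

/-- **Matthews (8.6)**: for integers `A, B` with `N = A² + B² ≠ 0` and any integer `r`,
`℘'_{ℤi+ℤ}(r/(Ai + B)) = -2N³ G₃(i; -rA, rB; N)` (Matthews: `℘'(rθ/ρ) = -2p³θ⁻³ G₃(i; -rA, rB; p)`,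
`ρ = Ai + B`, for his lattice `ℤ[i]θ`; here `θ = 1`). [cite: Matthews1979Quartic, §8 (8.6) p. 43] -/
theorem derivWeierstrassP_gaussian_div (A B r : ℤ) (N : ℕ) (hN : (N : ℤ) = A ^ 2 + B ^ 2)
    (hN0 : N ≠ 0) :
    ℘'[Λᵢ] ((r : ℂ) / ((A : ℂ) * Complex.I + B)) =
      -2 * (N : ℂ) ^ 3 *
        heckeG N 3 ![((-(r * A) : ℤ) : ZMod N), ((r * B : ℤ) : ZMod N)] UpperHalfPlane.I := by
  have hNC : (N : ℂ) ≠ 0 := by exact_mod_cast hN0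
  have hNC' : (N : ℂ) = (A : ℂ) ^ 2 + (B : ℂ) ^ 2 := by exact_mod_cast hN
  have hρ : (A : ℂ) * Complex.I + B ≠ 0 := by
    intro h
    apply hNC
    rw [hNC', show (A : ℂ) ^ 2 + (B : ℂ) ^ 2 = ((A : ℂ) * Complex.I + B) * (-(A : ℂ) * Complex.I + B) by
      ring_nf; rw [Complex.I_sq]; ring, h, zero_mul]
  set z : ℂ := (r : ℂ) / ((A : ℂ) * Complex.I + B) with hz
  rw [← (PeriodPair.hasSum_derivWeierstrassP (Λᵢ) z).tsum_eq,
    ← (finTwoArrowEquivLattice UpperHalfPlane.I).tsum_eq, heckeG,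
    ← (gaussianDivEquiv A B r N hN0).tsum_eq, ← tsum_mul_left]
  refine tsum_congr fun v ↦ ?_
  rw [coe_finTwoArrowEquivLattice]
  simp only [gaussianDivEquiv, Equiv.coe_fn_mk, eisSummand, UpperHalfPlane.coe_I, cons_val_zero,
    cons_val_one, Int.cast_sub, Int.cast_neg, Int.cast_mul, Int.cast_natCast]
  have hz' : z = (r : ℂ) * (-(A : ℂ) * Complex.I + B) / N := by
    rw [hz, div_eq_div_iff hρ hNC, hNC']
    ring_nf
    rw [Complex.I_sq]
    ring
  have hw : z - ((v 0 : ℂ) * Complex.I + v 1) =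
      ((-(r * A : ℂ) - N * v 0) * Complex.I + (r * B - N * v 1)) / N := by
    rw [hz']
    field_simp
    ring
  rw [hw, zpow_neg, zpow_ofNat, div_pow]
  field_simp

/-- **Matthews (8.10)**: for any `γ = (e f; -A B) ∈ SL₂(ℤ)` with bottom row `(-A, B)` (Matthews'
`g` of (8.7)–(8.8), `eB + fA = 1`; such `γ` exist iff `gcd(A, B) = 1`) and `N = A² + B²`,
`℘'_{ℤi+ℤ}(r/(Ai + B)) = -2N³ (B - Ai)⁻³ G₃(γ·i; 0, r; N)` (Matthews:
`℘'(rθ/ρ) = -2ρ³θ⁻³ G₃(g(i); 0, r; p)`, using `ρρ̄ = p`; (8.9) applied to `γ` at `τ = i`: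
`G₃(γ·i; 0, r) = (B - Ai)³ G₃(i; -rA, rB)`). [cite: Matthews1979Quartic, §8 (8.10) p. 44] -/
theorem derivWeierstrassP_gaussian_div_eq_smul (A B r : ℤ) (N : ℕ)
    (hN : (N : ℤ) = A ^ 2 + B ^ 2) (hN0 : N ≠ 0) (γ : SL(2, ℤ))
    (hγ0 : (γ : Matrix (Fin 2) (Fin 2) ℤ) 1 0 = -A) (hγ1 : (γ : Matrix (Fin 2) (Fin 2) ℤ) 1 1 = B) :
    ℘'[Λᵢ] ((r : ℂ) / ((A : ℂ) * Complex.I + B)) =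
      -2 * (N : ℂ) ^ 3 * ((B : ℂ) - (A : ℂ) * Complex.I)⁻¹ ^ 3 *
        heckeG N 3 ![(0 : ZMod N), ((r : ℤ) : ZMod N)] (γ • UpperHalfPlane.I) := by
  have hvec : (![(0 : ZMod N), ((r : ℤ) : ZMod N)] ᵥ* γ) =
      ![((-(r * A) : ℤ) : ZMod N), ((r * B : ℤ) : ZMod N)] := by
    ext i
    fin_cases i <;> simp [vecMul, dotProduct, Fin.sum_univ_two, hγ0, hγ1]
  have hden : denom γ UpperHalfPlane.I = (B : ℂ) - (A : ℂ) * Complex.I := by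
    rw [ModularGroup.denom_apply, hγ0, hγ1, UpperHalfPlane.coe_I]
    push_cast
    ring
  have hρ' : (B : ℂ) - (A : ℂ) * Complex.I ≠ 0 := by
    intro h
    have hNC' : (N : ℂ) = (A : ℂ) ^ 2 + (B : ℂ) ^ 2 := by exact_mod_cast hN
    have : (N : ℂ) = 0 := by
      rw [hNC', show (A : ℂ) ^ 2 + (B : ℂ) ^ 2 =
          ((B : ℂ) - (A : ℂ) * Complex.I) * ((B : ℂ) + (A : ℂ) * Complex.I) by
        ring_nf; rw [Complex.I_sq]; ring, h, zero_mul]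
    exact hN0 (by exact_mod_cast this)
  rw [heckeG_smul, hvec, hden, derivWeierstrassP_gaussian_div A B r N hN hN0]
  field_simp

end HeckeEisenstein

end Literature.NumberTheory.GaussSums
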